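import Summits.RiemannHypothesis.RiemannHypothesis.Theses.WeilParity
import Literature.NumberTheory.LFunctions.WeilZeroSum
import HarnessLib

/-!
# Line `mirror-torus` — strategist's ALT skeleton for crux `OffLineParityDetection`
(stmt-RiemannHypothesis-15431, route `WeilParity`, rank 2)

Crux (route decl, by name): an off-line zero of `ζ` makes the ODD Weil sector strictly undercut
the EVEN sector at some window `[-a, a]`.

## The lever (new relative to line `birth`/`registered`)

**Mirror pairing.** For a one-sided real bump `u` supported in `(0, a]` put `E = u + u(-·)`
(even) and `O = u - u(-·)` (odd): `‖E‖ = ‖O‖`, and by the parallelogram law + reflection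
invariance of Weil's form, `Q(E) = 2Q(u) + 2𝔅(u)`, `Q(O) = 2Q(u) - 2𝔅(u)` with the MIRROR
PAIRING `𝔅(u) = Re W(u ∗ u) = Re Σ_ρ m(ρ) û(ρ)²` (zero side).  `Q` is translation invariant,
so for `u(t) = f(a - t)` (profile `f` supported in `[0, ∞)`) ALL the window dependence of
`Q(O)` sits in the generalised Dirichlet series `a ↦ Σ_ρ m(ρ) F_f(ρ - ½)² e^{2(ρ-½)a}`
(`F_f` = Laplace transform of the profile) — the Landau-engine object of the tree's
`WeilConverse.expSum`.  Parity ORDER at window `a` is the TOP-HEAVINESS of the indefinite form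
`𝔅` relative to `Q` on one-sided bumps.

**Endpoint torus.** If the set `S` of off-line zeros is FINITE with top layer
`T = {ρ ∈ S : Re ρ = ½ + η₀}` (`η₀` = maximal offset), then to leading order `e^{2η₀a}` both
sector floors are extreme eigenvalues of ONE finite-rank indefinite form on profile space,
`M(θ) = Σ_{ρ∈T} m(ρ) (|C_ρ⟩⟨C_ρ| - |S_ρ⟩⟨S_ρ|)`, `C_ρ + iS_ρ = e^{iθ_ρ} e^{-(ρ-½)u}`,
`θ_ρ = (Im ρ)·a`: even floor `≈ 2e^{2η₀a} λ_min M(θ(a))`, odd floor `≈ -2e^{2η₀a} λ_max M(θ(a))`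
— the odd form is EXACTLY minus the even form.  The parity swap is the quarter turn
`θ ↦ θ - π/2` (`M ↦ -M`), and `P(θ) + P(θ - π/2)` is phase-FREE.  Odd strictly wins at leading
order iff `Φ(θ(a)) := λ_max + λ_min > 0` (TOP-HEAVY).  `J = 1` (dominant quadruple):
`Φ = m cos(2θ - arg z)/(2|z|)` (closed form, sign changes: line `birth`'s TRIAL).  `J ≥ 2`
(the lead's open RESONANT stub): `sup_a Φ(θ(a)) > 0` is the line's ζ-FREE finite-dimensional
stub `stub_torusTopHeavy`; it is PROVED for orbit closures invariant under the quarter turn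
(all irrational ordinate ratios, all even-coordinate-sum lattices: antisymmetry + Kronecker)
and numerically robust on the remaining odd-sum lattices (planner scans, 2026-08-17:
420 rational `J = 2` configurations and random `J ≤ 4` orbit scans, `sup Φ ≥ 0.9·sup|Φ|` in
every case; the naive strengthening "`Φ(0) > 0`" is FALSE in 79/400 random cases — recorded).

## Stubs (5) and composition

* `stub_realEvenReduction` (M, RH-free): even-sector lower bounds transfer from real to complex
  tests (`Q(e₁ + ie₂) = Q(e₁) + Q(e₂)`).  Same content as `birth`'s REAL.
* `stub_torusTopHeavy` (L, ζ-FREE, finite-dimensional; the line's load-bearing open stub): every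
  finite weighted top layer is top-heavy at SOME phase point of its orbit.
* `stub_bohrTransfer` (M, RH-free): top-heaviness at one phase point recurs along `a → ∞` with
  half the margin (simultaneous Dirichlet approximation; the forms move by `≤ ε Σ w/(2η₀)·‖f‖²`).
* `stub_finiteDefectLocalisation` (L, RH-free real analysis): `S` finite + top layer frequently
  top-heavy ⇒ detection against all REAL even tests (odd witness = mirror-odd partner
  `f(a-t) - f(a+t)` of the top-heavy profile, EXACT energy via the Dirichlet series; even floor
  from `explicit_formula_holds`: on-line terms `≥ 0`, lower layers `O(e^{2η'a})` by the landed
  Cauchy–Schwarz stub, top layer `= 2e^{2η₀a}·gain(a, ẽ)` exactly for `ẽ(u) = e(a-u)`).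
* `stub_infiniteDefectDetection` (XL, open core shared with `birth`'s INF): `S` infinite.
* `OffLineParityDetection_of` (sorry-free): `Set.finite_or_infinite S`; finite ⇒ maximal offset
  `η₀` (`Finset.exists_max_image`), top layer `T` as a `Finset` with a representative of real
  part `½ + η₀` (reflection `ρ ↦ 1 - ρ̄` of the zero set), weights `m(ρ) ≥ 1`; TORUS ⇒ BOHR ⇒
  LOCALISATION; infinite ⇒ INF; then REAL.

Disproof used: none on file for this crux (`ledger crux ls`, 2026-08-17).  Negatives index:
nothing on parity order.  Dead lines: none.
-/

set_option linter.dupNamespace false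

noncomputable section

namespace Summit.RiemannHypothesis.RiemannHypothesis.Cruxes.OffLineParityDetection.MirrorTorus

open MeasureTheory Set Filter
open scoped ComplexConjugate
open Literature.NumberTheory.LFunctions
open Summit.RiemannHypothesis.RiemannHypothesis.Theses.WeilParity (OffLineParityDetection)

/-! ### Registered stubs -/

/-- Stub **REAL** (RH-free; M): on any window, a lower bound `x` for `Re Q` valid on every
REAL-valued even `L²`-normalised Weil test supported in `[-a, a]` is valid on every complex-valued
even normalised Weil test supported in `[-a, a]` (`Q(e₁ + ie₂) = Q(e₁) + Q(e₂)` for real even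
`e₁, e₂`, tree `RuelleBandExactFirstBand.stub_evenComplexSector_zeroForm`; homogeneity
`weilQuadratic_const_mul`).  Same content as line `birth`'s `stub_realEvenSuffices`.
[cite: Bombieri2000Weil, §3–§4; Weil1952] -/
theorem stub_realEvenReduction :
    ∀ a x : ℝ,
      (∀ e : ℝ → ℂ, IsWeilTest e → tsupport e ⊆ Set.Icc (-a) a → (∀ t, e (-t) = e t) →
        (∀ t, (e t).im = 0) → ∫ t, ‖e t‖ ^ 2 = (1 : ℝ) → x ≤ (weilQuadratic e).re) →
      ∀ e : ℝ → ℂ, IsWeilTest e → tsupport e ⊆ Set.Icc (-a) a → (∀ t, e (-t) = e t) →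
        ∫ t, ‖e t‖ ^ 2 = (1 : ℝ) → x ≤ (weilQuadratic e).re := by
  sorry

/-- Stub **TORUS** (ζ-FREE, finite-dimensional; L; the line's load-bearing open stub).
For a finite nonempty "top layer" `T` of points of real part `1/2 + η₀` (`η₀ > 0`) with positive
weights `w`, the endpoint model is TOP-HEAVY at some phase point `a : ℝ` of its orbit: with the
Laplace transforms `F_f(z) = ∫₀^∞ f(u) e^{-zu} du` (`z = ρ - 1/2`) of smooth compactly supported
real profiles `f` on `[0, ∞)` and the normalised mirror-pairing form
`gain(a, f) = Σ_{ρ∈T} w(ρ) Re(e^{2i(Im ρ)a} F_f(ρ - 1/2)²)`, there are `δ > 0`, `a` and `D ≥ 0`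
with `-gain(a, f) ≤ D ‖f‖²` for ALL profiles (even danger `≤ D`) and `gain(a, f) ≥ (D + δ)‖f‖²`
for SOME profile (odd gain `≥ D + δ`).  Equivalently `λ_max M(θ) + λ_min M(θ) > 0` somewhere on
the orbit `θ = a·(Im ρ)_ρ` of the finite-rank form `M(θ) = Σ w (|C⟩⟨C| - |S⟩⟨S|)`.  PROVED
cases: `|T| = 1` (`Φ = w cos(2θ - arg z)/(2|z|)`); orbit closure invariant under the quarter
turn `θ ↦ θ - (π/2)·1` (Kronecker + the antisymmetry `Φ(θ - (π/2)1) = -Φ(θ)`), i.e. every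
configuration whose ordinate lattice has no odd-coordinate-sum relation.  OPEN: odd-sum
lattices (e.g. ordinates `γ, 2γ`), where the planner's scans (2026-08-17, 420 + random
configurations) give `sup Φ ≥ 0.9 sup |Φ|` without exception. [folklore] -/
theorem stub_torusTopHeavy :
    ∀ η₀ : ℝ, 0 < η₀ → ∀ T : Finset ℂ, T.Nonempty → (∀ ρ ∈ T, ρ.re = 1 / 2 + η₀) →
      ∀ w : ℂ → ℝ, (∀ ρ ∈ T, 0 < w ρ) →
      ∃ δ : ℝ, 0 < δ ∧ ∃ a : ℝ, ∃ D : ℝ, 0 ≤ D ∧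
        (∀ f : ℝ → ℝ, ContDiff ℝ (⊤ : ℕ∞) f → HasCompactSupport f → tsupport f ⊆ Set.Ici 0 →
          -(∑ ρ ∈ T, w ρ * (Complex.exp (2 * (ρ.im : ℂ) * (a : ℂ) * Complex.I) *
              (∫ u in Set.Ioi (0 : ℝ), (f u : ℂ) * Complex.exp (-((ρ - 1 / 2) * (u : ℂ)))) ^ 2).re)
            ≤ D * ∫ u in Set.Ioi (0 : ℝ), f u ^ 2) ∧
        (∃ f : ℝ → ℝ, ContDiff ℝ (⊤ : ℕ∞) f ∧ HasCompactSupport f ∧ tsupport f ⊆ Set.Ici 0 ∧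
          0 < ∫ u in Set.Ioi (0 : ℝ), f u ^ 2 ∧
          (D + δ) * ∫ u in Set.Ioi (0 : ℝ), f u ^ 2 ≤
            ∑ ρ ∈ T, w ρ * (Complex.exp (2 * (ρ.im : ℂ) * (a : ℂ) * Complex.I) *
              (∫ u in Set.Ioi (0 : ℝ), (f u : ℂ) * Complex.exp (-((ρ - 1 / 2) * (u : ℂ)))) ^ 2).re) := by
  sorry

/-- Stub **BOHR** (RH-free; M): top-heaviness at ONE phase point `a₀` recurs along `a → ∞`
with half the margin.  Mechanism: the forms depend on `a` only through the finitely many phases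
`e^{2i(Im ρ)a}`, `ρ ∈ T`; by simultaneous Dirichlet approximation the set of `τ` with
`|e^{2i(Im ρ)τ} - 1| ≤ ε` for all `ρ ∈ T` is relatively dense, hence unbounded above, and along
`a = a₀ + τ` every profile's gain moves by at most `ε Σ_ρ w(ρ) |F_f(ρ - 1/2)|² ≤
ε (Σ w)/(2η₀) · ‖f‖²` (Cauchy–Schwarz against `e^{-η₀u}`); take `ε (Σ w)/(2η₀) ≤ δ/4` and
`D' = D + δ/4`. [folklore] -/
theorem stub_bohrTransfer :
    ∀ η₀ : ℝ, 0 < η₀ → ∀ T : Finset ℂ, (∀ ρ ∈ T, ρ.re = 1 / 2 + η₀) →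
      ∀ w : ℂ → ℝ, (∀ ρ ∈ T, 0 ≤ w ρ) → ∀ a₀ δ : ℝ, 0 < δ →
      (∃ D : ℝ, 0 ≤ D ∧
        (∀ f : ℝ → ℝ, ContDiff ℝ (⊤ : ℕ∞) f → HasCompactSupport f → tsupport f ⊆ Set.Ici 0 →
          -(∑ ρ ∈ T, w ρ * (Complex.exp (2 * (ρ.im : ℂ) * (a₀ : ℂ) * Complex.I) *
              (∫ u in Set.Ioi (0 : ℝ), (f u : ℂ) * Complex.exp (-((ρ - 1 / 2) * (u : ℂ)))) ^ 2).re)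
            ≤ D * ∫ u in Set.Ioi (0 : ℝ), f u ^ 2) ∧
        (∃ f : ℝ → ℝ, ContDiff ℝ (⊤ : ℕ∞) f ∧ HasCompactSupport f ∧ tsupport f ⊆ Set.Ici 0 ∧
          0 < ∫ u in Set.Ioi (0 : ℝ), f u ^ 2 ∧
          (D + δ) * ∫ u in Set.Ioi (0 : ℝ), f u ^ 2 ≤
            ∑ ρ ∈ T, w ρ * (Complex.exp (2 * (ρ.im : ℂ) * (a₀ : ℂ) * Complex.I) *
              (∫ u in Set.Ioi (0 : ℝ), (f u : ℂ) * Complex.exp (-((ρ - 1 / 2) * (u : ℂ)))) ^ 2).re)) →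
      ∃ᶠ a : ℝ in Filter.atTop, ∃ D : ℝ, 0 ≤ D ∧
        (∀ f : ℝ → ℝ, ContDiff ℝ (⊤ : ℕ∞) f → HasCompactSupport f → tsupport f ⊆ Set.Ici 0 →
          -(∑ ρ ∈ T, w ρ * (Complex.exp (2 * (ρ.im : ℂ) * (a : ℂ) * Complex.I) *
              (∫ u in Set.Ioi (0 : ℝ), (f u : ℂ) * Complex.exp (-((ρ - 1 / 2) * (u : ℂ)))) ^ 2).re)
            ≤ D * ∫ u in Set.Ioi (0 : ℝ), f u ^ 2) ∧
        (∃ f : ℝ → ℝ, ContDiff ℝ (⊤ : ℕ∞) f ∧ HasCompactSupport f ∧ tsupport f ⊆ Set.Ici 0 ∧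
          0 < ∫ u in Set.Ioi (0 : ℝ), f u ^ 2 ∧
          (D + δ / 2) * ∫ u in Set.Ioi (0 : ℝ), f u ^ 2 ≤
            ∑ ρ ∈ T, w ρ * (Complex.exp (2 * (ρ.im : ℂ) * (a : ℂ) * Complex.I) *
              (∫ u in Set.Ioi (0 : ℝ), (f u : ℂ) * Complex.exp (-((ρ - 1 / 2) * (u : ℂ)))) ^ 2).re) := by
  sorry

/-- Stub **LOCALISATION** (RH-free real analysis; L): if the set `S` of off-line zeros of `ζ`
in the strip is FINITE, `η₀` bounds all offsets `|Re ρ - 1/2|` on `S`, the top layer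
`T = {ρ : ζ(ρ) = 0, Re ρ = 1/2 + η₀}` is nonempty and — with the weights `m(ρ)` — frequently
top-heavy along `a → ∞` with a fixed margin `δ`, then at some window `a > 0` some odd normalised
Weil test beats every REAL even normalised Weil test by a fixed margin.  Mechanism (exact
identities, finite sums, one smooth cutoff): pick a large top-heavy `a` beyond the profile's
support radius `R`; the odd witness is the mirror-odd partner `o(t) = f(a - t) - f(a + t)` of the
gaining profile `f` (a smooth odd test on `[-a, a]`, `‖o‖² = 2‖f‖²`), whose energy is EXACTLY
`Q(o) = 2Q(f(-·)) - 2 Re Σ_ρ m(ρ) e^{2(ρ-½)a} F_f(ρ-½)²` (zero side `WeilConverse.zeroForm` via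
`explicit_formula_holds`, `pairCoeff_of_odd_real`, translation invariance): top layer
`= -2e^{2η₀a}(gain ≥ (D+δ)‖f‖²)` (the reflected layer `Re ρ = 1/2 - η₀` contributes
`O(e^{-2η₀a})`), lower layers `O(e^{2η'a})`, `η' < η₀`, on-line and `Q(f(-·))` terms `O_f(1)`;
for a real even normalised `e` on `[-a, a]`, `Q(e) = Σ_ρ m(ρ) Re ê(ρ)²`
(`stub_evenTransfer_pairCoeff`) `≥` (top layer) `+` (lower layers) (on-line terms `|ê|² ≥ 0`
dropped), lower layers `≥ -Σ m ‖sinh(η'·) sin(γ·)‖² = -O(e^{2η'a})` (landed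
`stub_evenOffLineCauchySchwarz`), top layer `= 2e^{2η₀a} gain(a, ẽ)` EXACTLY for the profile
`ẽ(u) = e(a - u)` on `[0, 2a]`, and `gain(a, ẽ) ≥ gain(a, ẽψ) - O(e^{-η₀a/2}) ≥ -D/2 - o(1)`
for a smooth cutoff `ψ` to `[0, a]` (`‖ẽψ‖² ≤ 1/2`).  Margin `≍ δ e^{2η₀a} → ∞`. [folklore] -/
theorem stub_finiteDefectLocalisation :
    ∀ hS : ({ρ : ℂ | riemannZeta ρ = 0 ∧ 0 < ρ.re ∧ ρ.re < 1 ∧ ρ.re ≠ 1 / 2}).Finite,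
      ∀ η₀ : ℝ, 0 < η₀ →
      (∀ ρ : ℂ, riemannZeta ρ = 0 → 0 < ρ.re → ρ.re < 1 → ρ.re ≠ 1 / 2 → |ρ.re - 1 / 2| ≤ η₀) →
      ∀ T : Finset ℂ, (∀ ρ : ℂ, ρ ∈ T ↔ (riemannZeta ρ = 0 ∧ ρ.re = 1 / 2 + η₀)) → T.Nonempty →
      (∃ δ : ℝ, 0 < δ ∧ ∃ᶠ a : ℝ in Filter.atTop, ∃ D : ℝ, 0 ≤ D ∧
        (∀ f : ℝ → ℝ, ContDiff ℝ (⊤ : ℕ∞) f → HasCompactSupport f → tsupport f ⊆ Set.Ici 0 →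
          -(∑ ρ ∈ T, (riemannZetaZeroOrder ρ : ℝ) *
              (Complex.exp (2 * (ρ.im : ℂ) * (a : ℂ) * Complex.I) *
              (∫ u in Set.Ioi (0 : ℝ), (f u : ℂ) * Complex.exp (-((ρ - 1 / 2) * (u : ℂ)))) ^ 2).re)
            ≤ D * ∫ u in Set.Ioi (0 : ℝ), f u ^ 2) ∧
        (∃ f : ℝ → ℝ, ContDiff ℝ (⊤ : ℕ∞) f ∧ HasCompactSupport f ∧ tsupport f ⊆ Set.Ici 0 ∧
          0 < ∫ u in Set.Ioi (0 : ℝ), f u ^ 2 ∧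
          (D + δ) * ∫ u in Set.Ioi (0 : ℝ), f u ^ 2 ≤
            ∑ ρ ∈ T, (riemannZetaZeroOrder ρ : ℝ) *
              (Complex.exp (2 * (ρ.im : ℂ) * (a : ℂ) * Complex.I) *
              (∫ u in Set.Ioi (0 : ℝ), (f u : ℂ) * Complex.exp (-((ρ - 1 / 2) * (u : ℂ)))) ^ 2).re)) →
      ∃ a : ℝ, 0 < a ∧ ∃ o : ℝ → ℂ, IsWeilTest o ∧ tsupport o ⊆ Set.Icc (-a) a ∧
        (∀ t, o (-t) = -o t) ∧ ∫ t, ‖o t‖ ^ 2 = (1 : ℝ) ∧ ∃ m : ℝ, 0 < m ∧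
        ∀ e : ℝ → ℂ, IsWeilTest e → tsupport e ⊆ Set.Icc (-a) a → (∀ t, e (-t) = e t) →
          (∀ t, (e t).im = 0) → ∫ t, ‖e t‖ ^ 2 = (1 : ℝ) →
          (weilQuadratic o).re + m ≤ (weilQuadratic e).re := by
  sorry

/-- Stub **INF** (the crux's XL open core, shared in content with line `birth`'s
`stub_infiniteDefectDetection`): if the set of off-line zeros of `ζ` in the strip is INFINITE,
then at some window `a > 0` some odd normalised Weil test beats every REAL even normalised Weil
test by a fixed margin.  No finite top layer need exist (offsets may accumulate, the supremal
offset may be unattained or attained infinitely often); the even floor then needs large-sieve /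
Bessel control of `Σ_off m (Im ê(ρ))²` in place of the finite Cauchy–Schwarz threshold, and the
mirror-pairing Dirichlet series `Σ m F² e^{2(ρ-½)a}` has infinitely many growing terms.
[cite: Bombieri2000Weil, Thm. 8, §11, §13; ConnesSuijlekom2025] -/
theorem stub_infiniteDefectDetection :
    ({ρ : ℂ | riemannZeta ρ = 0 ∧ 0 < ρ.re ∧ ρ.re < 1 ∧ ρ.re ≠ 1 / 2}).Infinite →
      ∃ a : ℝ, 0 < a ∧ ∃ o : ℝ → ℂ, IsWeilTest o ∧ tsupport o ⊆ Set.Icc (-a) a ∧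
        (∀ t, o (-t) = -o t) ∧ ∫ t, ‖o t‖ ^ 2 = (1 : ℝ) ∧ ∃ m : ℝ, 0 < m ∧
        ∀ e : ℝ → ℂ, IsWeilTest e → tsupport e ⊆ Set.Icc (-a) a → (∀ t, e (-t) = e t) →
          (∀ t, (e t).im = 0) → ∫ t, ‖e t‖ ^ 2 = (1 : ℝ) →
          (weilQuadratic o).re + m ≤ (weilQuadratic e).re := by
  sorry

/-! ### Stub statements by name -/

namespace Statement

/-- Statement of `stub_realEvenReduction`. -/
abbrev stub_realEvenReduction : Prop := type_of% @MirrorTorus.stub_realEvenReduction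
/-- Statement of `stub_torusTopHeavy`. -/
abbrev stub_torusTopHeavy : Prop := type_of% @MirrorTorus.stub_torusTopHeavy
/-- Statement of `stub_bohrTransfer`. -/
abbrev stub_bohrTransfer : Prop := type_of% @MirrorTorus.stub_bohrTransfer
/-- Statement of `stub_finiteDefectLocalisation`. -/
abbrev stub_finiteDefectLocalisation : Prop := type_of% @MirrorTorus.stub_finiteDefectLocalisation
/-- Statement of `stub_infiniteDefectDetection`. -/
abbrev stub_infiniteDefectDetection : Prop := type_of% @MirrorTorus.stub_infiniteDefectDetection

end Statement

/-! ### The finite-defect case from TORUS + BOHR + LOCALISATION (kernel-checked) -/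

/-- **FIN, real-even form** (sorry-free): if the off-line set `S` is finite and nonempty, some
odd normalised test beats every real even normalised test at some window.  The maximal offset
`η₀` is attained on the finite set (`Finset.exists_max_image`); the top layer
`T = {ζ = 0, Re = 1/2 + η₀}` is a sub-`Finset` of `S`, nonempty because the reflection
`ρ ↦ 1 - ρ̄` of the zero set (`one_sub_conj_mem`) turns a maximal-offset zero of real part
`1/2 - η₀` into one of real part `1/2 + η₀`; the weights `m(ρ) ≥ 1` on `T` (`one_le_order`);
then TORUS gives a top-heavy phase point, BOHR makes it recur along `a → ∞`, LOCALISATION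
detects. [folklore] -/
theorem finiteDefectDetection_of (hTorus : Statement.stub_torusTopHeavy)
    (hBohr : Statement.stub_bohrTransfer) (hLoc : Statement.stub_finiteDefectLocalisation)
    (hS : ({ρ : ℂ | riemannZeta ρ = 0 ∧ 0 < ρ.re ∧ ρ.re < 1 ∧ ρ.re ≠ 1 / 2}).Finite)
    {ρ : ℂ} (hζ : riemannZeta ρ = 0) (h0 : 0 < ρ.re) (h1 : ρ.re < 1) (hne : ρ.re ≠ 1 / 2) :
    ∃ a : ℝ, 0 < a ∧ ∃ o : ℝ → ℂ, IsWeilTest o ∧ tsupport o ⊆ Set.Icc (-a) a ∧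
      (∀ t, o (-t) = -o t) ∧ ∫ t, ‖o t‖ ^ 2 = (1 : ℝ) ∧ ∃ m : ℝ, 0 < m ∧
      ∀ e : ℝ → ℂ, IsWeilTest e → tsupport e ⊆ Set.Icc (-a) a → (∀ t, e (-t) = e t) →
        (∀ t, (e t).im = 0) → ∫ t, ‖e t‖ ^ 2 = (1 : ℝ) →
        (weilQuadratic o).re + m ≤ (weilQuadratic e).re := by
  classical
  -- the maximal offset `η₀` over the finite nonempty set `S`
  have hρS : ρ ∈ hS.toFinset := hS.mem_toFinset.2 ⟨hζ, h0, h1, hne⟩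
  obtain ⟨ρ₁, hρ₁, hmax⟩ :=
    hS.toFinset.exists_max_image (fun ρ : ℂ ↦ |ρ.re - 1 / 2|) ⟨ρ, hρS⟩
  obtain ⟨hζ₁, h0₁, h1₁, hne₁⟩ := hS.mem_toFinset.1 hρ₁
  set η₀ : ℝ := |ρ₁.re - 1 / 2| with hη₀def
  have hη₀ : 0 < η₀ := abs_pos.2 (sub_ne_zero.2 hne₁)
  have hbound : ∀ ρ' : ℂ, riemannZeta ρ' = 0 → 0 < ρ'.re → ρ'.re < 1 → ρ'.re ≠ 1 / 2 →
      |ρ'.re - 1 / 2| ≤ η₀ :=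
    fun ρ' hz h0' h1' hne' ↦ hmax ρ' (hS.mem_toFinset.2 ⟨hz, h0', h1', hne'⟩)
  -- the top layer as a Finset
  set T : Finset ℂ := hS.toFinset.filter (fun ρ' : ℂ ↦ ρ'.re = 1 / 2 + η₀) with hTdef
  have hTmem : ∀ ρ' : ℂ, ρ' ∈ T ↔ (riemannZeta ρ' = 0 ∧ ρ'.re = 1 / 2 + η₀) := by
    intro ρ'
    rw [hTdef, Finset.mem_filter, Set.Finite.mem_toFinset, Set.mem_setOf_eq]
    constructor
    · rintro ⟨⟨hz, -, -, -⟩, hre⟩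
      exact ⟨hz, hre⟩
    · rintro ⟨hz, hre⟩
      refine ⟨⟨hz, by linarith, ?_, by linarith⟩, hre⟩
      exact Literature.NumberTheory.LFunctions.re_lt_one_of_riemannZeta_eq_zero hz
  have hTre : ∀ ρ' ∈ T, ρ'.re = 1 / 2 + η₀ := fun ρ' h ↦ ((hTmem ρ').1 h).2
  -- nonemptiness: a representative of real part `1/2 + η₀`
  have hTne : T.Nonempty := by
    rcases lt_or_gt_of_ne hne₁ with hlt | hgt
    · -- `Re ρ₁ < 1/2`: use `1 - conj ρ₁`
      have hmem₁ : ρ₁ ∈ ZetaZeros.riemannZetaNontrivialZeros :=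
        ZetaZeros.riemannZetaNontrivialZeros.mem_of_re_pos hζ₁ h0₁
      have hmem₂ := ZetaZeros.riemannZetaNontrivialZeros.one_sub_conj_mem hmem₁
      refine ⟨1 - conj ρ₁, (hTmem _).2 ⟨ZetaZeros.riemannZetaNontrivialZeros.zeta_eq_zero hmem₂, ?_⟩⟩
      have habs : η₀ = -(ρ₁.re - 1 / 2) := by rw [hη₀def]; exact abs_of_neg (by linarith)
      simp only [Complex.sub_re, Complex.one_re, Complex.conj_re]
      linarith
    · -- `Re ρ₁ > 1/2`: use `ρ₁`
      refine ⟨ρ₁, (hTmem _).2 ⟨hζ₁, ?_⟩⟩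
      have habs : η₀ = ρ₁.re - 1 / 2 := by rw [hη₀def]; exact abs_of_pos (by linarith)
      linarith
  -- weights `m(ρ) ≥ 1 > 0` on `T`
  have hwpos : ∀ ρ' ∈ T, 0 < (riemannZetaZeroOrder ρ' : ℝ) := by
    intro ρ' h
    obtain ⟨hz, hre⟩ := (hTmem ρ').1 h
    have hmem : ρ' ∈ ZetaZeros.riemannZetaNontrivialZeros :=
      ZetaZeros.riemannZetaNontrivialZeros.mem_of_re_pos hz (by linarith)
    exact_mod_cast ZetaZeros.riemannZetaNontrivialZeros.one_le_order hmem
  have hwnn : ∀ ρ' ∈ T, 0 ≤ (riemannZetaZeroOrder ρ' : ℝ) := fun ρ' h ↦ (hwpos ρ' h).le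
  -- TORUS ⇒ BOHR ⇒ LOCALISATION
  obtain ⟨δ, hδ, a₀, hTH⟩ :=
    hTorus η₀ hη₀ T hTne hTre (fun ρ' ↦ (riemannZetaZeroOrder ρ' : ℝ)) hwpos
  have hfreq := hBohr η₀ hη₀ T hTre (fun ρ' ↦ (riemannZetaZeroOrder ρ' : ℝ)) hwnn a₀ δ hδ hTH
  exact hLoc hS η₀ hη₀ hbound T hTmem hTne ⟨δ / 2, by linarith, hfreq⟩

/-! ### Bridge to the lead's skeleton: RESONANT from TORUS + BOHR + LOCALISATION -/

/-- **Reshape offer for the live line `registered`** (sorry-free modulo the three statements):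
the lead's open stub `stub_resonantFiniteDefectDetection` (its registered signature, verbatim,
including the unused no-dominant-quadruple hypothesis) follows from TORUS + BOHR + LOCALISATION —
the torus treatment does not distinguish dominant from resonant top layers.  With
`x := Re Q(o) + m` and `ε_od(a) ≤ Re Q(o)` (`weilOddGroundEnergy_le`). So the lead may replace
RESONANT by {`stub_torusTopHeavy`, `stub_bohrTransfer`, `stub_finiteDefectLocalisation`} at a
cycle boundary (5 stubs with TRIAL and INF), keeping its composition. [folklore] -/
theorem resonantFiniteDefectDetection_of (hTorus : Statement.stub_torusTopHeavy)
    (hBohr : Statement.stub_bohrTransfer) (hLoc : Statement.stub_finiteDefectLocalisation) :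
    ({ρ : ℂ | riemannZeta ρ = 0 ∧ 0 < ρ.re ∧ ρ.re < 1 ∧ ρ.re ≠ 1 / 2}).Finite →
      (∃ ρ : ℂ, riemannZeta ρ = 0 ∧ 0 < ρ.re ∧ ρ.re < 1 ∧ ρ.re ≠ 1 / 2) →
      (¬ ∃ ρ₀ ∈ {ρ : ℂ | riemannZeta ρ = 0 ∧ 0 < ρ.re ∧ ρ.re < 1 ∧ ρ.re ≠ 1 / 2},
          ∀ ρ ∈ {ρ : ℂ | riemannZeta ρ = 0 ∧ 0 < ρ.re ∧ ρ.re < 1 ∧ ρ.re ≠ 1 / 2},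
            |ρ.re - 1 / 2| < |ρ₀.re - 1 / 2| ∨ ρ = ρ₀ ∨ ρ = conj ρ₀ ∨ ρ = 1 - ρ₀ ∨
              ρ = 1 - conj ρ₀) →
      ∃ a : ℝ, 0 < a ∧ ∃ x : ℝ, weilOddGroundEnergy a < x ∧
        ∀ e : ℝ → ℂ, IsWeilTest e → tsupport e ⊆ Set.Icc (-a) a → (∀ t, e (-t) = e t) →
          (∀ t, (e t).im = 0) → ∫ t, ‖e t‖ ^ 2 = (1 : ℝ) → x ≤ (weilQuadratic e).re := by
  intro hS hne _hnodom
  obtain ⟨ρ, hζ, h0, h1, hne'⟩ := hne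
  obtain ⟨a, ha, o, ho, hos, hodd, hon, m, hm, hdet⟩ :=
    finiteDefectDetection_of hTorus hBohr hLoc hS hζ h0 h1 hne'
  refine ⟨a, ha, (weilQuadratic o).re + m, ?_, fun e he hes hev hreal hen ↦ hdet e he hes hev hreal hen⟩
  have hle : weilOddGroundEnergy a ≤ (weilQuadratic o).re := weilOddGroundEnergy_le ho hos hodd hon
  linarith

/-- The same bridge in line `birth`'s planner form (FIN: finite nonempty off-line set ⇒ window
threshold below every real even normalised test), for completeness. [folklore] -/
theorem finiteDefectThreshold_of (hTorus : Statement.stub_torusTopHeavy)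
    (hBohr : Statement.stub_bohrTransfer) (hLoc : Statement.stub_finiteDefectLocalisation) :
    ({ρ : ℂ | riemannZeta ρ = 0 ∧ 0 < ρ.re ∧ ρ.re < 1 ∧ ρ.re ≠ 1 / 2}).Finite →
      (∃ ρ : ℂ, riemannZeta ρ = 0 ∧ 0 < ρ.re ∧ ρ.re < 1 ∧ ρ.re ≠ 1 / 2) →
      ∃ a : ℝ, 0 < a ∧ ∃ x : ℝ, weilOddGroundEnergy a < x ∧
        ∀ e : ℝ → ℂ, IsWeilTest e → tsupport e ⊆ Set.Icc (-a) a → (∀ t, e (-t) = e t) →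
          (∀ t, (e t).im = 0) → ∫ t, ‖e t‖ ^ 2 = (1 : ℝ) → x ≤ (weilQuadratic e).re := by
  intro hS hne
  obtain ⟨ρ, hζ, h0, h1, hne'⟩ := hne
  obtain ⟨a, ha, o, ho, hos, hodd, hon, m, hm, hdet⟩ :=
    finiteDefectDetection_of hTorus hBohr hLoc hS hζ h0 h1 hne'
  refine ⟨a, ha, (weilQuadratic o).re + m, ?_, fun e he hes hev hreal hen ↦ hdet e he hes hev hreal hen⟩
  have hle : weilOddGroundEnergy a ≤ (weilQuadratic o).re := weilOddGroundEnergy_le ho hos hodd hon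
  linarith

/-! ### The crux from the stubs (kernel-checked composition, no `sorry`) -/

/-- **The crux BY NAME from the five stub statements** (REAL, TORUS, BOHR, LOCALISATION, INF →
`WeilParity.OffLineParityDetection`): given an off-line zero `ρ`, the off-line set `S` is
finite (`finiteDefectDetection_of`) or infinite (INF); either way some odd normalised test `o`
beats every REAL even normalised test at some window by a margin `m > 0`, and REAL transfers the
bound `Re Q(o) + m ≤ Re Q(e)` to complex even tests. [folklore] -/
theorem OffLineParityDetection_of (hReal : Statement.stub_realEvenReduction)
    (hTorus : Statement.stub_torusTopHeavy) (hBohr : Statement.stub_bohrTransfer)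
    (hLoc : Statement.stub_finiteDefectLocalisation)
    (hInf : Statement.stub_infiniteDefectDetection) : OffLineParityDetection := by
  intro ρ hζ h0 h1 hne
  obtain ⟨a, ha, o, ho, hos, hodd, hon, m, hm, hdet⟩ :
      ∃ a : ℝ, 0 < a ∧ ∃ o : ℝ → ℂ, IsWeilTest o ∧ tsupport o ⊆ Set.Icc (-a) a ∧
        (∀ t, o (-t) = -o t) ∧ ∫ t, ‖o t‖ ^ 2 = (1 : ℝ) ∧ ∃ m : ℝ, 0 < m ∧
        ∀ e : ℝ → ℂ, IsWeilTest e → tsupport e ⊆ Set.Icc (-a) a → (∀ t, e (-t) = e t) →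
          (∀ t, (e t).im = 0) → ∫ t, ‖e t‖ ^ 2 = (1 : ℝ) →
          (weilQuadratic o).re + m ≤ (weilQuadratic e).re := by
    rcases ({ρ : ℂ | riemannZeta ρ = 0 ∧ 0 < ρ.re ∧ ρ.re < 1 ∧ ρ.re ≠ 1 / 2}).finite_or_infinite
      with hS | hS
    · exact finiteDefectDetection_of hTorus hBohr hLoc hS hζ h0 h1 hne
    · exact hInf hS
  refine ⟨a, ha, o, ho, hos, hodd, hon, m, hm, ?_⟩
  intro e he hes hev hen
  exact hReal a ((weilQuadratic o).re + m)
    (fun e' he' hes' hev' hreal' hen' ↦ hdet e' he' hes' hev' hreal' hen') e he hes hev hen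

/-- The crux along this line (route `WeilParity` decl, by name), MODULO exactly the five
registered stubs (depends on `sorryAx` only through `stub_*`). [folklore] -/
theorem OffLineParityDetection_proof : OffLineParityDetection :=
  OffLineParityDetection_of stub_realEvenReduction stub_torusTopHeavy stub_bohrTransfer
    stub_finiteDefectLocalisation stub_infiniteDefectDetection

end Summit.RiemannHypothesis.RiemannHypothesis.Cruxes.OffLineParityDetection.MirrorTorus

end
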